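import Mathlib
import Summits.RiemannHypothesis.RiemannHypothesis.Theses.SpectralTrace
import Summits.RiemannHypothesis.RiemannHypothesis.Theorems.WindowTraceArch.Negative.ComplexSpectrum
import Summits.RiemannHypothesis.RiemannHypothesis.Theorems.WindowTraceArch.Negative.LocalWeyl
import Literature.NumberTheory.LFunctions.WeilExplicitProofs
import Literature.NumberTheory.LFunctions.WeilCriterionProofs
import Literature.NumberTheory.LFunctions.WeilArchimedeanPositivityProofs
import Summits.RiemannHypothesis.RiemannHypothesis.Theorems.WindowTraceArch.Negative.UnitMass
import Summits.RiemannHypothesis.RiemannHypothesis.Theorems.WindowTraceArch.Negative.FiniteSpectrum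

/-!
# Sketch — crux `SpectralIsHpSpectrum` (stmt-RiemannHypothesis-0195), crux-ideate round 1, ideator 1

First-lemma signatures for the three idea cards (A `translation-orbit-charfun`,
B `dilation-peak-local-weyl`, C `test-algebra-stone-weierstrass`) and the shared transfer
`RealWeilSpectrumUnique → SpectralIsHpSpectrum`.  PROVED here: the shared transfer `spectralIsHpSpectrum_of_unique : RealWeilSpectrumUnique → SpectralIsHpSpectrum`
(and the W-free `spectralIsHpSpectrum_of_realSpectrumUnique`), the Σ-fibre count `ncard_zetaOrdinates_fibre`, the
calibration `isRealSpectrumFor_zetaOrdinates`, card A's translation lemmas, card C's conj-closure lemma, and six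
engine-applicability examples. Sorried: the 11 first-lemma statements of the three cards (no skeleton at this stage).
-/

noncomputable section

open Complex Set MeasureTheory Filter
open scoped Real Topology

/-! ## VENDORED COPY of `Cruxes/SpectralIsHpSpectrum/Disproof.lean` §0–§2 (refuter-cdisprove, commit of 2026-08-16T02:30Z)
Copied verbatim under the namespace `…Sketch.DisproofCopy` ONLY because the Lean farm had not yet built the module
`Summits.RiemannHypothesis.RiemannHypothesis.Cruxes.SpectralIsHpSpectrum.Disproof` at filing time (lean check rc 75
`remote:stale:unbuilt`). A crux-plan skeleton should `import …Cruxes.SpectralIsHpSpectrum.Disproof` and delete this block;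
all credit for §0–§2 is the disprover's. -/
namespace Summit.RiemannHypothesis.RiemannHypothesis.Cruxes.SpectralIsHpSpectrum.Sketch.DisproofCopy

open Literature.NumberTheory.LFunctions
open Summit.RiemannHypothesis.RiemannHypothesis.Theses.SpectralTrace (SpectralIsHpSpectrum)
open Summit.RiemannHypothesis.RiemannHypothesis.Theorems.WindowTraceArch.Negative

/-! ## §0 Vocabulary (definitional abbreviations of the crux's pieces) -/

/-- The hypothesis of the crux on a real family `γ`: it reproduces `W` on every Weil test
(this is the route target `X` instantiated at `γ`). [folklore] -/
def IsTrace {ι : Type*} (γ : ι → ℝ) : Prop :=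
  ∀ g : ℝ → ℂ, IsWeilTest g →
    HasSum (fun i => weilMellin g (1 / 2 + (γ i : ℂ) * I)) (weilFunctional g)

/-- The right-hand side of the crux: multiplicity of `z` as a NON-TRIVIAL zero, in `ℕ∞`. [folklore] -/
def mult (z : ℂ) : ℕ∞ :=
  ZetaZeros.riemannZetaNontrivialZeros.indicator (fun w => (analyticOrderNatAt riemannZeta w : ℕ∞)) z

/-- The fibre of the family over `z`. [folklore] -/
def fibre {ι : Type*} (γ : ι → ℝ) (z : ℂ) : Set ι :=
  {i : ι | (1 / 2 : ℂ) + (γ i : ℂ) * I = z}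

/-- The crux, unfolded into the vocabulary above (definitional). [folklore] -/
theorem spectralIsHpSpectrum_iff :
    SpectralIsHpSpectrum ↔
      ∀ (ι : Type) (γ : ι → ℝ), IsTrace γ → ∀ z : ℂ, (fibre γ z).encard = mult z :=
  Iff.rfl

/-! ## §1 Why no unconditional kill exists: the hypothesis proves RH -/

/-- A full trace is a window trace on every window. [folklore] -/
theorem windowTrace_of_isTrace {ι : Type*} {γ : ι → ℝ} (h : IsTrace γ) (A : ℝ) :
    ∀ g : ℝ → ℂ, IsWeilTest g → tsupport g ⊆ Icc (-A) A →
      HasSum (fun i => weilMellin g (1 / 2 + (γ i : ℂ) * I)) (weilFunctional g) :=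
  fun g hg _ => h g hg

/-- A compactly supported function is supported in some `[-R, R]`, `R > 0`. [folklore] -/
theorem exists_tsupport_subset_Icc {g : ℝ → ℂ} (hg : HasCompactSupport g) :
    ∃ R : ℝ, 0 < R ∧ tsupport g ⊆ Icc (-R) R := by
  obtain ⟨R, hR⟩ := hg.isCompact.isBounded.subset_closedBall 0
  refine ⟨max R 1, by positivity, hR.trans fun x hx => ?_⟩
  rw [Metric.mem_closedBall, dist_zero_right, Real.norm_eq_abs] at hx
  have h1 := le_max_left R 1
  exact ⟨by linarith [neg_abs_le x], by linarith [le_abs_self x]⟩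

/-- **Bochner form of a full trace**: `HasSum (i ↦ |ĝ(1/2+iγ_i)|²) (Re Q(g))` for every Weil test
(`hasSum_norm_sq_of_windowTrace` on a window containing `supp (g ⋆ g̃)`). [folklore] -/
theorem hasSum_norm_sq_of_isTrace {ι : Type*} {γ : ι → ℝ} (h : IsTrace γ) {g : ℝ → ℂ}
    (hg : IsWeilTest g) :
    HasSum (fun i => ‖weilMellin g (1 / 2 + (γ i : ℂ) * I)‖ ^ 2) (weilQuadratic g).re := by
  obtain ⟨R, -, hR⟩ := exists_tsupport_subset_Icc hg.2
  refine hasSum_norm_sq_of_windowTrace (A := 2 * R) (windowTrace_of_isTrace h (2 * R)) hg ?_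
  rwa [show (2 * R) / 2 = R by ring]

/-- A full trace gives Weil positivity. [folklore] -/
theorem weilPositivity_of_isTrace {ι : Type*} {γ : ι → ℝ} (h : IsTrace γ) : WeilPositivity :=
  fun _ hg => (hasSum_norm_sq_of_isTrace h hg).nonneg fun _ => by positivity

/-- **Any family satisfying the hypothesis of the crux proves RH** (Weil's criterion,
`weil_criterion_holds`). [folklore] -/
theorem riemannHypothesis_of_isTrace {ι : Type*} {γ : ι → ℝ} (h : IsTrace γ) :
    _root_.RiemannHypothesis :=
  (show _root_.RiemannHypothesis ↔ WeilPositivity from weil_criterion_holds).2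
    (weilPositivity_of_isTrace h)

/-- **Vacuity branch**: if RH fails the crux holds (no family satisfies its hypothesis). [folklore] -/
theorem spectralIsHpSpectrum_of_not_riemannHypothesis (hRH : ¬ _root_.RiemannHypothesis) :
    SpectralIsHpSpectrum :=
  fun _ _ hγ => absurd (riemannHypothesis_of_isTrace hγ) hRH

/-- **Barrier: a refutation of the crux is a proof of RH.** [folklore] -/
theorem riemannHypothesis_of_not_spectralIsHpSpectrum (h : ¬ SpectralIsHpSpectrum) :
    _root_.RiemannHypothesis := by
  by_contra hRH
  exact h (spectralIsHpSpectrum_of_not_riemannHypothesis hRH)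

/-- The crux is equivalent to its restriction to the RH world. [folklore] -/
theorem spectralIsHpSpectrum_iff_under_rh :
    SpectralIsHpSpectrum ↔ (_root_.RiemannHypothesis → SpectralIsHpSpectrum) := by
  refine ⟨fun h _ => h, fun h => ?_⟩
  by_cases hRH : _root_.RiemannHypothesis
  · exact h hRH
  · exact spectralIsHpSpectrum_of_not_riemannHypothesis hRH

/-! ## §2 The reduction handed to the prover -/

/-- Membership in a fibre: `z` must be on the critical line and `γ_i = Im z`. [folklore] -/
theorem mem_fibre_iff {ι : Type*} (γ : ι → ℝ) (z : ℂ) (i : ι) :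
    i ∈ fibre γ z ↔ z.re = 1 / 2 ∧ γ i = z.im := by
  simp only [fibre, mem_setOf_eq]
  constructor
  · rintro rfl
    simp
  · rintro ⟨hre, him⟩
    apply Complex.ext <;> simp [hre, him]

/-- Off the critical line every fibre is empty. [folklore] -/
theorem fibre_eq_empty_of_re_ne {ι : Type*} (γ : ι → ℝ) {z : ℂ} (hz : z.re ≠ 1 / 2) :
    fibre γ z = ∅ := by
  ext i
  simp only [mem_fibre_iff, mem_empty_iff_false, iff_false, not_and]
  exact fun h _ => hz h

/-- On the critical line the fibre over `1/2 + iτ` is `{i | γ_i = τ}`. [folklore] -/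
theorem fibre_half_add {ι : Type*} (γ : ι → ℝ) (τ : ℝ) :
    fibre γ (1 / 2 + τ * I) = {i | γ i = τ} := by
  ext i
  simp [mem_fibre_iff]

/-- **Every fibre of a trace family is finite** (local finiteness, `finite_abs_le_of_windowTrace`
from the landed local Weyl law); so the left-hand side of the crux is never `⊤`. [folklore] -/
theorem finite_fibre {ι : Type*} {γ : ι → ℝ} (h : IsTrace γ) (z : ℂ) : (fibre γ z).Finite :=
  (finite_abs_le_of_windowTrace one_pos (windowTrace_of_isTrace h 1) |z.im|).subset fun i hi => by
    have him := ((mem_fibre_iff γ z i).1 hi).2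
    show |γ i| ≤ |z.im|
    rw [him]

/-- The analytic order of `ζ` is finite away from the pole (identity principle, `ζ(2) ≠ 0`).
[folklore] -/
theorem analyticOrderAt_riemannZeta_ne_top' {ρ : ℂ} (h : ρ ≠ 1) :
    analyticOrderAt riemannZeta ρ ≠ ⊤ := by
  intro htop
  have h2 : riemannZeta 2 = 0 :=
    analyticOn_riemannZeta.eqOn_zero_of_preconnected_of_eventuallyEq_zero
      (isConnected_compl_singleton_of_one_lt_rank (by simp) (1 : ℂ)).isPreconnected h
      (analyticOrderAt_eq_top.mp htop) (show (2 : ℂ) ∈ ({1}ᶜ : Set ℂ) by norm_num)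
  exact riemannZeta_ne_zero_of_one_le_re (s := 2) (by norm_num) h2

/-- `mult z = 0` off the non-trivial zeros. [folklore] -/
theorem mult_of_not_mem {z : ℂ} (hz : z ∉ ZetaZeros.riemannZetaNontrivialZeros) : mult z = 0 :=
  Set.indicator_of_notMem hz _

/-- At a non-trivial zero, `mult z` is the analytic order of `ζ`. [folklore] -/
theorem mult_of_mem {z : ℂ} (hz : z ∈ ZetaZeros.riemannZetaNontrivialZeros) :
    mult z = analyticOrderAt riemannZeta z := by
  rw [mult, Set.indicator_of_mem hz, Nat.cast_analyticOrderNatAt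
    (analyticOrderAt_riemannZeta_ne_top' (ZetaZeros.riemannZetaNontrivialZeros.ne_one hz))]

/-- The right-hand side of the crux is never `⊤`. [folklore] -/
theorem mult_ne_top (z : ℂ) : mult z ≠ ⊤ := by
  by_cases hz : z ∈ ZetaZeros.riemannZetaNontrivialZeros
  · rw [mult_of_mem hz]
    exact analyticOrderAt_riemannZeta_ne_top' (ZetaZeros.riemannZetaNontrivialZeros.ne_one hz)
  · rw [mult_of_not_mem hz]
    exact ENat.coe_ne_top 0

/-- Under RH the non-trivial zeros are on the critical line (unfolding Mathlib's clauses).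
[folklore] -/
theorem re_eq_half_of_mem (hRH : _root_.RiemannHypothesis) {z : ℂ}
    (hz : z ∈ ZetaZeros.riemannZetaNontrivialZeros) : z.re = 1 / 2 := by
  refine hRH z (ZetaZeros.riemannZetaNontrivialZeros.zeta_eq_zero hz) ?_
    (ZetaZeros.riemannZetaNontrivialZeros.ne_one hz)
  rintro ⟨n, hn⟩
  have h0 := ZetaZeros.riemannZetaNontrivialZeros.re_pos hz
  rw [hn] at h0
  simp at h0
  linarith [n.cast_nonneg (α := ℝ)]

/-- **Off the critical line both sides of the crux vanish** for a trace family (the fibre is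
empty; the hypothesis gives RH, which empties the right-hand side). [folklore] -/
theorem encard_fibre_eq_mult_of_re_ne_half {ι : Type*} {γ : ι → ℝ} (h : IsTrace γ) {z : ℂ}
    (hz : z.re ≠ 1 / 2) : (fibre γ z).encard = mult z := by
  rw [fibre_eq_empty_of_re_ne γ hz, Set.encard_empty,
    mult_of_not_mem fun hmem => hz (re_eq_half_of_mem (riemannHypothesis_of_isTrace h) hmem)]

/-- In the open strip, `mult s` IS the analytic order — no case split on `ζ s = 0` survives.
[folklore] -/
theorem mult_eq_analyticOrderAt_of_mem_strip {s : ℂ} (h0 : 0 < s.re) (h1 : s.re < 1) :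
    mult s = analyticOrderAt riemannZeta s := by
  by_cases hζ : riemannZeta s = 0
  · exact mult_of_mem (ZetaZeros.riemannZetaNontrivialZeros.mem_of_re_pos hζ h0)
  · rw [mult_of_not_mem fun h => hζ (ZetaZeros.riemannZetaNontrivialZeros.zeta_eq_zero h)]
    have hs : s ≠ 1 := by
      intro h; rw [h] at h1; simp at h1
    exact ((analyticOn_riemannZeta s hs).analyticOrderAt_eq_zero.2 hζ).symm

/-- `m(s) = analyticOrderNatAt ζ s` for every `s ≠ 1`: the explicit formula's multiplicity is the
crux's multiplicity. [folklore] -/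
theorem riemannZetaZeroOrder_eq_analyticOrderNatAt {s : ℂ} (hs : s ≠ 1) :
    riemannZetaZeroOrder s = (analyticOrderNatAt riemannZeta s : ℤ) := by
  have ha : AnalyticAt ℂ riemannZeta s := analyticOn_riemannZeta s hs
  obtain ⟨n, hn⟩ := ENat.ne_top_iff_exists.mp (analyticOrderAt_riemannZeta_ne_top' hs)
  rw [riemannZetaZeroOrder, ha.meromorphicOrderAt_eq, ← hn, ENat.map_coe, WithTop.untop₀_coe,
    analyticOrderNatAt, ← hn, ENat.toNat_coe]

/-- A point `1/2 + iτ` of the critical line is not the pole. [folklore] -/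
theorem half_add_ne_one (τ : ℝ) : (1 / 2 : ℂ) + τ * I ≠ 1 := by
  intro h
  have := congrArg Complex.re h
  norm_num at this

/-- **On the critical line the crux's equation is `#{i | γ_i = τ} = m(1/2+iτ)` in `ℤ`**, for any
family with finite fibres. [folklore] -/
theorem encard_fibre_eq_mult_iff {ι : Type*} (γ : ι → ℝ) (τ : ℝ) (hfin : {i | γ i = τ}.Finite) :
    (fibre γ (1 / 2 + τ * I)).encard = mult (1 / 2 + τ * I) ↔
      (({i : ι | γ i = τ}.ncard : ℕ) : ℤ) = riemannZetaZeroOrder (1 / 2 + τ * I) := by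
  have hs : (1 / 2 : ℂ) + τ * I ≠ 1 := half_add_ne_one τ
  obtain ⟨n, hn⟩ := ENat.ne_top_iff_exists.mp (analyticOrderAt_riemannZeta_ne_top' hs)
  have hnat : analyticOrderNatAt riemannZeta (1 / 2 + τ * I) = n := by
    rw [analyticOrderNatAt, ← hn, ENat.toNat_coe]
  rw [fibre_half_add, mult_eq_analyticOrderAt_of_mem_strip (by simp) (by norm_num),
    riemannZetaZeroOrder_eq_analyticOrderNatAt hs, hnat, ← hn, ← hfin.cast_ncard_eq, Nat.cast_inj,
    Nat.cast_inj]

/-- **THE REDUCTION.** The crux is equivalent to: for every real family reproducing `W` on all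
Weil tests and every real `τ`, the number of indices with `γ_i = τ` equals the multiplicity
`m(1/2 + iτ)` of the explicit formula (`riemannZetaZeroOrder`; `0` when `ζ(1/2+iτ) ≠ 0`).
All `encard`/`indicator`/`analyticOrderNatAt`/off-line bookkeeping is discharged here. [folklore] -/
theorem spectralIsHpSpectrum_iff_ordinate_count :
    SpectralIsHpSpectrum ↔ ∀ (ι : Type) (γ : ι → ℝ), IsTrace γ →
      ∀ τ : ℝ, (({i : ι | γ i = τ}.ncard : ℕ) : ℤ) = riemannZetaZeroOrder (1 / 2 + τ * I) := by
  rw [spectralIsHpSpectrum_iff]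
  constructor
  · intro h ι γ hγ τ
    have hfin : {i | γ i = τ}.Finite := by simpa only [fibre_half_add] using finite_fibre hγ (1 / 2 + τ * I)
    exact (encard_fibre_eq_mult_iff γ τ hfin).1 (h ι γ hγ _)
  · intro h ι γ hγ z
    by_cases hz : z.re = 1 / 2
    · have hzeq : z = 1 / 2 + (z.im : ℝ) * I := by
        apply Complex.ext <;> simp [hz]
      have hfin : {i | γ i = z.im}.Finite := by
        simpa only [fibre_half_add] using finite_fibre hγ (1 / 2 + (z.im : ℝ) * I)
      rw [hzeq]
      exact (encard_fibre_eq_mult_iff γ z.im hfin).2 (h ι γ hγ z.im)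
    · exact encard_fibre_eq_mult_of_re_ne_half hγ hz

/-- **THE REDUCTION, RH granted.** Since the hypothesis proves RH (§1), the prover may assume RH:
then `ρ = 1/2 + i Im ρ` for every non-trivial zero (`eq_half_add_of_riemannHypothesis`) and the
explicit formula (`hasSum_weilMellin_zeros`) is a second real trace; what remains is uniqueness of
the counting measure of a real trace (Fourier uniqueness for tempered positive measures).
[folklore] -/
theorem spectralIsHpSpectrum_iff_rigidity_under_rh :
    SpectralIsHpSpectrum ↔ ∀ (ι : Type) (γ : ι → ℝ), _root_.RiemannHypothesis → IsTrace γ →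
      ∀ τ : ℝ, (({i : ι | γ i = τ}.ncard : ℕ) : ℤ) = riemannZetaZeroOrder (1 / 2 + τ * I) := by
  rw [spectralIsHpSpectrum_iff_ordinate_count]
  exact ⟨fun h ι γ _ hγ => h ι γ hγ, fun h ι γ hγ => h ι γ (riemannHypothesis_of_isTrace hγ) hγ⟩

/-- Under RH the ordinates of the non-trivial zeros, repeated with multiplicity, form a trace
family (the calibration `SpectralConverse`, from the landed `hasSum_weilMellin_zeros`). [folklore] -/
theorem isTrace_ordinates_of_rh (hRH : _root_.RiemannHypothesis) :
    IsTrace (fun p : (Σ ρ : ZetaZeros.riemannZetaNontrivialZeros,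
      Fin (riemannZetaZeroOrder (ρ : ℂ)).toNat) => (p.1 : ℂ).im) :=
  fun _ hg => by simpa only [eq_half_add_of_riemannHypothesis hRH] using hasSum_weilMellin_zeros hg

end Summit.RiemannHypothesis.RiemannHypothesis.Cruxes.SpectralIsHpSpectrum.Sketch.DisproofCopy


namespace Summit.RiemannHypothesis.RiemannHypothesis.Cruxes.SpectralIsHpSpectrum.Sketch

open Literature.NumberTheory.LFunctions
open Summit.RiemannHypothesis.RiemannHypothesis.Theorems.WindowTraceArch.Negative

/-! ## Shared vocabulary and the transfer C⁺ -/

/-- `γ` is a real spectrum for the functional `L`: `Σ_i ĝ(1/2 + iγ_i) = L g` (HasSum) on every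
Weil test. The crux hypothesis is `IsRealSpectrumFor γ weilFunctional`. -/
def IsRealSpectrumFor {ι : Type*} (γ : ι → ℝ) (L : (ℝ → ℂ) → ℂ) : Prop :=
  ∀ g : ℝ → ℂ, IsWeilTest g → HasSum (fun i => weilMellin g (1 / 2 + (γ i : ℂ) * I)) (L g)

/-- TRANSFER C⁺ (W-free form, cards A and C): two real spectra of the SAME functional have the
same multiplicities. -/
def RealSpectrumUnique : Prop :=
  ∀ (ι ι' : Type) (γ : ι → ℝ) (γ' : ι' → ℝ) (L : (ℝ → ℂ) → ℂ),
    IsRealSpectrumFor γ L → IsRealSpectrumFor γ' L →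
      ∀ x : ℝ, {i | γ i = x}.encard = {j | γ' j = x}.encard

/-- TRANSFER C⁺_W (card B: needs the local Weyl law, hence `L = weilFunctional`). -/
def RealWeilSpectrumUnique : Prop :=
  ∀ (ι ι' : Type) (γ : ι → ℝ) (γ' : ι' → ℝ),
    IsRealSpectrumFor γ weilFunctional → IsRealSpectrumFor γ' weilFunctional →
      ∀ x : ℝ, {i | γ i = x}.encard = {j | γ' j = x}.encard

theorem realWeilSpectrumUnique_of_realSpectrumUnique (h : RealSpectrumUnique) :
    RealWeilSpectrumUnique :=
  fun ι ι' γ γ' hγ hγ' x => h ι ι' γ γ' weilFunctional hγ hγ' x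

/-- The canonical real spectrum under RH: ordinates of the non-trivial zeros repeated with
multiplicity (index type of `hasSum_weilMellin_zeros`). -/
def zetaOrdinates :
    (Σ ρ : ZetaZeros.riemannZetaNontrivialZeros, Fin (riemannZetaZeroOrder (ρ : ℂ)).toNat) → ℝ :=
  fun p => (p.1 : ℂ).im

/-- Calibration (landed ingredients: `hasSum_weilMellin_zeros`, `eq_half_add_of_riemannHypothesis`). -/
theorem isRealSpectrumFor_zetaOrdinates (hRH : _root_.RiemannHypothesis) :
    IsRealSpectrumFor zetaOrdinates weilFunctional := by
  intro g hg
  simpa only [zetaOrdinates, eq_half_add_of_riemannHypothesis hRH] using hasSum_weilMellin_zeros hg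

/-- A real spectrum of `W` forces RH — this is the standing disprover's §1
(`DisproofCopy.riemannHypothesis_of_isTrace`, kernel-checked; `IsTrace γ` is definitionally
`IsRealSpectrumFor γ weilFunctional`). -/
theorem riemannHypothesis_of_isRealSpectrumFor {ι : Type*} {γ : ι → ℝ}
    (hγ : IsRealSpectrumFor γ weilFunctional) : _root_.RiemannHypothesis :=
  DisproofCopy.riemannHypothesis_of_isTrace hγ

/-- Fibre count of the canonical family: `#{p : Im ρ_p = τ} = m(1/2 + iτ)` under RH. -/
theorem ncard_zetaOrdinates_fibre (hRH : _root_.RiemannHypothesis) (τ : ℝ) :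
    (({p | zetaOrdinates p = τ}.ncard : ℕ) : ℤ) = riemannZetaZeroOrder (1 / 2 + τ * I) := by
  set s : ℂ := 1 / 2 + τ * I with hs_def
  have hs1 : s ≠ 1 := DisproofCopy.half_add_ne_one τ
  by_cases hz : s ∈ ZetaZeros.riemannZetaNontrivialZeros
  · have hset : {p : (Σ ρ : ZetaZeros.riemannZetaNontrivialZeros,
        Fin (riemannZetaZeroOrder (ρ : ℂ)).toNat) | zetaOrdinates p = τ} =
        Set.range (Sigma.mk (β := fun ρ : ZetaZeros.riemannZetaNontrivialZeros =>
          Fin (riemannZetaZeroOrder (ρ : ℂ)).toNat) ⟨s, hz⟩) := by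
      ext p
      simp only [Set.mem_setOf_eq, Set.mem_range, zetaOrdinates]
      constructor
      · intro hp
        obtain ⟨ρ, c⟩ := p
        have hρ : ρ = ⟨s, hz⟩ := by
          apply Subtype.ext
          have h1 := eq_half_add_of_riemannHypothesis hRH ρ
          simp only at hp
          rw [← h1, hp]
        subst hρ
        exact ⟨c, rfl⟩
      · rintro ⟨c, rfl⟩
        simp [hs_def]
    rw [hset, Set.ncard_range_of_injective sigma_mk_injective, Nat.card_eq_fintype_card,
      Fintype.card_fin]
    have h1 := ZetaZeros.riemannZetaNontrivialZeros.one_le_order hz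
    change (((riemannZetaZeroOrder s).toNat : ℕ) : ℤ) = riemannZetaZeroOrder s
    exact Int.toNat_of_nonneg (by omega)
  · have hset : {p : (Σ ρ : ZetaZeros.riemannZetaNontrivialZeros,
        Fin (riemannZetaZeroOrder (ρ : ℂ)).toNat) | zetaOrdinates p = τ} = ∅ := by
      ext p
      simp only [Set.mem_setOf_eq, Set.mem_empty_iff_false, iff_false, zetaOrdinates]
      intro hp
      apply hz
      have h1 := eq_half_add_of_riemannHypothesis hRH p.1
      rw [hp] at h1
      rw [hs_def, h1]
      exact p.1.2
    rw [hset, Set.ncard_empty]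
    have h0 : ¬ 0 < riemannZetaZeroOrder s := by
      rw [riemannZetaZeroOrder_pos_iff hs1]
      intro hζ
      exact hz (ZetaZeros.riemannZetaNontrivialZeros.mem_of_re_pos hζ (by simp [hs_def]))
    have h2 := riemannZetaZeroOrder_nonneg hs1
    push_cast
    omega

/-- **Shared reduction (kernel-checked modulo nothing)**: the transfer closes the crux BY NAME.
Uses the standing disprover's §2 `spectralIsHpSpectrum_iff_ordinate_count` (all
`encard`/indicator/off-line bookkeeping) and §1 (RH from the hypothesis). -/
theorem spectralIsHpSpectrum_of_unique (hU : RealWeilSpectrumUnique) :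
    Summit.RiemannHypothesis.RiemannHypothesis.Theses.SpectralTrace.SpectralIsHpSpectrum := by
  rw [DisproofCopy.spectralIsHpSpectrum_iff_ordinate_count]
  intro ι γ hγ τ
  have hRH : _root_.RiemannHypothesis := DisproofCopy.riemannHypothesis_of_isTrace hγ
  have hord : IsRealSpectrumFor zetaOrdinates weilFunctional := isRealSpectrumFor_zetaOrdinates hRH
  have hfinγ : {i | γ i = τ}.Finite := by
    simpa only [DisproofCopy.fibre_half_add] using DisproofCopy.finite_fibre hγ (1 / 2 + τ * I)
  have hfino : {p | zetaOrdinates p = τ}.Finite := by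
    simpa only [DisproofCopy.fibre_half_add] using DisproofCopy.finite_fibre hord (1 / 2 + τ * I)
  have h := hU ι _ γ zetaOrdinates hγ hord τ
  rw [← hfinγ.cast_ncard_eq, ← hfino.cast_ncard_eq, Nat.cast_inj] at h
  rw [← ncard_zetaOrdinates_fibre hRH τ, h]

/-- The W-free transfer closes the crux as well. -/
theorem spectralIsHpSpectrum_of_realSpectrumUnique (hU : RealSpectrumUnique) :
    Summit.RiemannHypothesis.RiemannHypothesis.Theses.SpectralTrace.SpectralIsHpSpectrum :=
  spectralIsHpSpectrum_of_unique (realWeilSpectrumUnique_of_realSpectrumUnique hU)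

/-! ## Card A — translation orbit ⇒ characteristic function of the weighted spectral measure -/

/-- Translates of Weil tests are Weil tests. (cheapest falsifier of card A, part 1) -/
theorem isWeilTest_translate {g : ℝ → ℂ} (hg : IsWeilTest g) (a : ℝ) :
    IsWeilTest fun t => g (t - a) := by
  refine ⟨hg.1.comp (contDiff_id.sub contDiff_const), ?_⟩
  exact hg.2.comp_homeomorph (Homeomorph.subRight a)

/-- **Translation covariance on the critical line**: `(τ_a g)^(1/2 + iu) = e^{iua} ĝ(1/2 + iu)`.
(cheapest falsifier of card A, part 2) -/
theorem weilMellin_translate (g : ℝ → ℂ) (a u : ℝ) :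
    weilMellin (fun t => g (t - a)) (1 / 2 + u * I) =
      cexp (((u * a : ℝ) : ℂ) * I) * weilMellin g (1 / 2 + u * I) := by
  unfold weilMellin
  beta_reduce
  have h := integral_sub_right_eq_self (μ := (volume : Measure ℝ))
    (fun s : ℝ => g s * cexp ((1 / 2 + (u : ℂ) * I - 1 / 2) * ((s + a : ℝ) : ℂ))) a
  simp only [sub_add_cancel] at h
  rw [h, ← integral_const_mul]
  refine integral_congr_ae (Eventually.of_forall fun s => ?_)
  simp only
  rw [mul_left_comm, ← Complex.exp_add]
  congr 2
  push_cast
  ring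

/-- The spectral measure weighted by a non-negative spectral weight `w`. -/
def weightedSpectralMeasure {ι : Type*} (γ : ι → ℝ) (w : ℝ → ℝ) : Measure ℝ :=
  Measure.sum fun i => ENNReal.ofReal (w (γ i)) • Measure.dirac (γ i)

/-- It is finite when the weight is `|k̂|²` of a Weil test (`Σ_i |k̂(γ_i)|² = Re L(k ⋆ k̃) < ∞`). -/
theorem isFiniteMeasure_weightedSpectralMeasure {ι : Type*} {γ : ι → ℝ} {L : (ℝ → ℂ) → ℂ}
    (hγ : IsRealSpectrumFor γ L) {k : ℝ → ℂ} (hk : IsWeilTest k) :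
    IsFiniteMeasure (weightedSpectralMeasure γ fun u => ‖weilMellin k (1 / 2 + u * I)‖ ^ 2) := by
  sorry

/-- **First lemma of card A.** The characteristic function of the weighted spectral measure is
the translation orbit of ONE test: `t ↦ L(τ_t (k ⋆ k̃))`. -/
theorem charFun_weightedSpectralMeasure {ι : Type*} {γ : ι → ℝ} {L : (ℝ → ℂ) → ℂ}
    (hγ : IsRealSpectrumFor γ L) {k : ℝ → ℂ} (hk : IsWeilTest k) (t : ℝ) :
    charFun (weightedSpectralMeasure γ fun u => ‖weilMellin k (1 / 2 + u * I)‖ ^ 2) t =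
      L (fun s => weilConv k (weilReflect k) (s - t)) := by
  sorry

/-- Atom read-out: the weighted measure of `{x}` is `|k̂(x)|² · #{i : γ_i = x}`. -/
theorem weightedSpectralMeasure_singleton {ι : Type*} (γ : ι → ℝ) (w : ℝ → ℝ) (x : ℝ) :
    weightedSpectralMeasure γ w {x} = ENNReal.ofReal (w x) * {i | γ i = x}.encard := by
  sorry

/-- Card A closes the W-free transfer (Mathlib `Measure.ext_of_charFun` + modulated bumps
`isWeilTest_modulate` / `weilMellin_modulate` / `exists_bump_lower` to make `w(x) > 0`). -/
theorem realSpectrumUnique_via_charFun : RealSpectrumUnique := by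
  sorry

/-! ## Card B — dilation orbit (peak functions) under the local Weyl law -/

/-- Local Weyl domination for FULL families (from the landed `card_near_le_log_of_windowTrace`). -/
theorem summable_inv_one_add_sq {ι : Type*} {γ : ι → ℝ}
    (hγ : IsRealSpectrumFor γ weilFunctional) (x : ℝ) :
    Summable fun i => 1 / (1 + (γ i - x) ^ 2) := by
  sorry

/-- Dilation of a test: `(D_n h)(t) = n⁻¹ h(t/n)` has `(D_n h)^(1/2+iu) = ĥ(1/2 + i n u)`. -/
theorem weilMellin_dilate (h : ℝ → ℂ) {n : ℝ} (hn : 0 < n) (u : ℝ) :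
    weilMellin (fun t => (n : ℂ)⁻¹ * h (t / n)) (1 / 2 + u * I) =
      weilMellin h (1 / 2 + ((n * u : ℝ) : ℂ) * I) := by
  sorry

/-- **First lemma of card B (Wiener-type atom extraction).** A peak sequence `φ(n(γ − x))`
dominated by `1/(1+u²)` reads off the multiplicity at `x`. -/
theorem tendsto_tsum_peak {ι : Type*} {γ : ι → ℝ} (x : ℝ)
    (hs : Summable fun i => 1 / (1 + (γ i - x) ^ 2)) {φ : ℝ → ℝ} (hφ0 : φ 0 = 1)
    (hφ : ∀ u, |φ u| ≤ 1 / (1 + u ^ 2)) :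
    Tendsto (fun n : ℕ => ∑' i, φ ((n + 1 : ℝ) * (γ i - x))) atTop
      (𝓝 ({i | γ i = x}.ncard : ℝ)) := by
  sorry

/-- Card B closes the W-form of the transfer. -/
theorem realWeilSpectrumUnique_via_peaks : RealWeilSpectrumUnique := by
  sorry

/-! ## Card C — the test transforms form a separating *-algebra (Stone–Weierstrass) -/

/-- Reflection is conjugation on the critical line: `(g̃)^(1/2+iu) = conj ĝ(1/2+iu)`. -/
theorem weilMellin_weilReflect_half (g : ℝ → ℂ) (u : ℝ) :
    weilMellin (weilReflect g) (1 / 2 + u * I) = (starRingEnd ℂ) (weilMellin g (1 / 2 + u * I)) := by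
  have h := weilMellin_weilReflect_holds g (1 / 2 + u * I)
  rw [h]
  congr 2
  apply Complex.ext <;> simp <;> norm_num

/-- Point separation by Weil tests (modulated bump). -/
theorem exists_weilTest_separates {x y : ℝ} (hxy : x ≠ y) :
    ∃ g : ℝ → ℂ, IsWeilTest g ∧ weilMellin g (1 / 2 + x * I) ≠ weilMellin g (1 / 2 + y * I) := by
  sorry

/-- **First lemma of card C.** Finite measures on `ℝ` with equal mass that agree on all Weil
transforms `u ↦ ĝ(1/2+iu)` are equal (Stone–Weierstrass on `OnePoint ℝ` +
`ext_of_forall_integral_eq_of_IsFiniteMeasure`). -/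
theorem measure_ext_of_weilTests {μ ν : Measure ℝ} [IsFiniteMeasure μ] [IsFiniteMeasure ν]
    (hmass : μ univ = ν univ)
    (h : ∀ g : ℝ → ℂ, IsWeilTest g →
      ∫ u, weilMellin g (1 / 2 + u * I) ∂μ = ∫ u, weilMellin g (1 / 2 + u * I) ∂ν) :
    μ = ν := by
  sorry

/-- Card C closes the W-free transfer. -/
theorem realSpectrumUnique_via_stoneWeierstrass : RealSpectrumUnique := by
  sorry

/-! ## Cheapest-falsifier checks (engine applicability; all must elaborate) -/

/-- Card A engine: Lévy uniqueness for finite measures on `ℝ` is in Mathlib with the instances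
`ℝ` carries. -/
example (μ ν : Measure ℝ) [IsFiniteMeasure μ] [IsFiniteMeasure ν]
    (h : charFun μ = charFun ν) : μ = ν :=
  Measure.ext_of_charFun h

/-- Card A engine, pointwise form of the characteristic function on `ℝ`. -/
example (μ : Measure ℝ) (t : ℝ) : charFun μ t = ∫ x, cexp (((x * t : ℝ) : ℂ) * I) ∂μ := by
  rw [charFun_apply]
  simp [mul_comm]

/-- Card B engine 1: the landed local Weyl law accepts a FULL real spectrum (window `A = 1`,
support hypothesis discarded). -/
example {ι : Type*} {γ : ι → ℝ} (hγ : IsRealSpectrumFor γ weilFunctional) :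
    ∃ C : ℝ, 0 < C ∧ ∀ (T : ℝ) (s : Finset ι), (∀ i ∈ s, |γ i - T| ≤ 1) →
      (s.card : ℝ) ≤ C * (1 + Real.log (1 + |T|)) :=
  card_near_le_log_of_windowTrace one_pos fun g hg _ => hγ g hg

/-- Card B engine 2: Tannery's theorem (dominated convergence for `tsum`) is in Mathlib. -/
example {ι : Type*} (f : ℕ → ι → ℝ) (g bound : ι → ℝ) (hb : Summable bound)
    (hlim : ∀ i, Tendsto (fun n => f n i) atTop (𝓝 (g i)))
    (hdom : ∀ᶠ n in atTop, ∀ i, ‖f n i‖ ≤ bound i) :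
    Tendsto (fun n => ∑' i, f n i) atTop (𝓝 (∑' i, g i)) :=
  tendsto_tsum_of_dominated_convergence hb hlim hdom

/-- Card C engine 1: Stone–Weierstrass on the one-point compactification of `ℝ`. -/
example (A : StarSubalgebra ℂ C(OnePoint ℝ, ℂ)) (hA : A.SeparatesPoints) :
    A.topologicalClosure = ⊤ :=
  ContinuousMap.starSubalgebra_topologicalClosure_eq_top_of_separatesPoints A hA

/-- Card C engine 2: extension of a Weil transform by `0` to the one-point compactification
(`OnePoint.continuousMapMk`; the decay hypothesis `h0` is `norm_weilMellin_le_sq`). Measures are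
NOT pushed to `OnePoint ℝ` (no canonical `MeasurableSpace`/`HasOuterApproxClosed` there — checked:
both fail to synthesize); atoms are read on `ℝ` through tent functions instead. -/
example (g : ℝ → ℂ) (hc : Continuous fun u : ℝ => weilMellin g (1 / 2 + u * I))
    (h0 : Tendsto (fun u : ℝ => weilMellin g (1 / 2 + u * I)) (coclosedCompact ℝ) (𝓝 0)) :
    C(OnePoint ℝ, ℂ) :=
  OnePoint.continuousMapMk ⟨fun u : ℝ => weilMellin g (1 / 2 + u * I), hc⟩ 0 h0

end Summit.RiemannHypothesis.RiemannHypothesis.Cruxes.SpectralIsHpSpectrum.Sketch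

end
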